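import Summits.Ventures.PercRepro.C025ProfileTwoFlatPLDMoves

/-!
# PER-LAYER DOMINANCE ON TWO UNIFORM FLATS — INJECTIVITY ACROSS THE FLATS (night-3 g27)

`proofs/NIGHT3-G27-PLD.md` §4.  The injectivity pairs of the two-flat injection in which the two images are built on
DIFFERENT overflowing flats: `S₁_ne_L₂`, `L₁_ne_S₂`, `L₁_ne_L₂` (the partner part of one image is a small absorber while
the other source overflows there — impossible), and `S₁_ne_S₂`: if the S-image of a flat-1-overflow source `σ` equals the
S-image of a flat-2-overflow source `τ`, the crossed pair `C₁ σ = (τ's absorber, D₁; σ's absorber, D₂)` is a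
non-overflowing residual source — `σ` is blocked.  This is where the heredity of the selectors is used
(`kept_of_subset`).  No `def`, no `instance`, no notation.  Axioms: standard.
-/

namespace PercRepro

namespace TwoFlatPLD

open Finset

variable {α β : Type} [DecidableEq α] [DecidableEq β]

/-- **S₁ vs L₂**: the flat-2 part of the S₁-image is the complement of a small absorber; as the flat-2 part of an L₂-image it
would be the complement of an overflowing part. -/
theorem S₁_ne_L₂ (F₁ : Finset α) (F₂ : Finset β) (s₁ s₂ : ℕ) (J₁ : Finset α → Finset α) (J₂ : Finset β → Finset β)
    (hJ₂ : ∀ X, J₂ X ⊆ X) (lo hi δ : ℕ)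
    (RS : Finset ((Finset α × Finset α) × (Finset β × Finset β)))
    (hRS : ∀ σ : (Finset α × Finset α) × (Finset β × Finset β), σ ∈ RS ↔ σ.1.1 ⊆ F₁ ∧ σ.2.1 ⊆ F₂ ∧
      σ.1.2 ⊆ J₁ (F₁ \ σ.1.1) ∧ σ.2.2 ⊆ J₂ (F₂ \ σ.2.1) ∧
      σ.1.2.card + σ.2.2.card = δ ∧ lo ≤ min σ.1.1.card s₁ + min σ.2.1.card s₂ ∧
      min σ.1.1.card s₁ + min σ.2.1.card s₂ ≤ hi ∧
      hi + δ + 1 ≤ min (F₁.card - σ.1.1.card) s₁ + min (F₂.card - σ.2.1.card) s₂)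
    (φ₁ : Finset α → ℕ → ℕ → Finset α → Finset α)
    (φ₂ : Finset β → ℕ → ℕ → Finset β → Finset β)
    (hφ₂ : ∀ (S : Finset β) (i j : ℕ), i ≤ j → i + j ≤ S.card →
      (Set.InjOn (φ₂ S i j) (S.powersetCard i) ∧ ∀ I ∈ S.powersetCard i, φ₂ S i j I ∈ S.powersetCard j ∧ I ⊆ φ₂ S i j I))
    (σ τ : (Finset α × Finset α) × (Finset β × Finset β)) (hσ : σ ∈ RS) (hτ : τ ∈ RS)
    (s1 : s₁ < min σ.1.1.card s₁ + σ.1.2.card) (t2 : s₂ < min τ.2.1.card s₂ + τ.2.2.card) (h : ((σ.1.1, σ.1.2), ((F₂ \ (φ₂ (F₂ \ σ.2.2) σ.2.1.card (σ.2.1.card + (min σ.1.1.card s₁ + σ.1.2.card - min (F₁.card - σ.1.1.card) s₁)) σ.2.1)) \ σ.2.2, σ.2.2)) = (((F₁ \ (φ₁ (F₁ \ τ.1.2) τ.1.1.card (τ.1.1.card + (min τ.2.1.card s₂ + τ.2.2.card - s₂)) τ.1.1)) \ τ.1.2, τ.1.2), ((F₂ \ τ.2.1) \ τ.2.2, τ.2.2)))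 : False := by
  obtain ⟨y1, y2, y3, -, -⟩ := absorb_S₁ F₁ F₂ s₁ s₂ J₁ J₂ hJ₂ lo hi δ RS hRS φ₂ hφ₂ σ hσ s1
  obtain ⟨⟨I₁, D₁⟩, ⟨I₂, D₂⟩⟩ := σ
  obtain ⟨⟨I₁', D₁'⟩, ⟨I₂', D₂'⟩⟩ := τ
  simp only [Prod.mk.injEq] at h
  obtain ⟨⟨e1, e2⟩, ⟨e3, e4⟩⟩ := h
  subst e2; subst e4
  obtain ⟨sI₁, sI₂, sD₁, sD₂, sδ, slo, shi, sf⟩ := (hRS _).1 hσ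
  obtain ⟨tI₁, tI₂, tD₁, tD₂, tδ, tlo, thi, tf⟩ := (hRS _).1 hτ
  dsimp only at sI₁ sI₂ sD₁ sD₂ sδ slo shi sf tI₁ tI₂ tD₁ tD₂ tδ tlo thi tf s1 t2 e1 e3
  dsimp only at y1 y2 y3
  have hDY : D₂ ⊆ F₂ \ φ₂ (F₂ \ D₂) I₂.card (I₂.card + (min I₁.card s₁ + D₁.card - min (F₁.card - I₁.card) s₁)) I₂ := by
    intro d hd
    rw [mem_sdiff]
    exact ⟨(mem_sdiff.1 (sD₂.trans (hJ₂ _) hd)).1, fun hdY => (mem_sdiff.1 (y1 hdY)).2 hd⟩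
  have hYeq : φ₂ (F₂ \ D₂) I₂.card (I₂.card + (min I₁.card s₁ + D₁.card - min (F₁.card - I₁.card) s₁)) I₂ = I₂' :=
    eq_of_sdiff_sdiff_eq (y1.trans sdiff_subset) tI₂ hDY (tD₂.trans (hJ₂ _)) e3
  have hc := congrArg Finset.card hYeq
  rw [y2] at hc
  obtain ⟨r1, -, -, -⟩ := residual_facts (k_o := F₁.card) (i_o := I₁.card) (s_o := s₁)
    (δ_o := D₁.card) (k_p := F₂.card) (i_p := I₂.card) (s_p := s₂) (δ_p := D₂.card)
    sδ shi sf s1 (card_le_card sI₁) (card_le_card sI₂)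
  omega

/-- **L₁ vs S₂**, the mirror of `S₁_ne_L₂` on flat 1. -/
theorem L₁_ne_S₂ (F₁ : Finset α) (F₂ : Finset β) (s₁ s₂ : ℕ) (J₁ : Finset α → Finset α) (J₂ : Finset β → Finset β)
    (hJ₁ : ∀ X, J₁ X ⊆ X) (lo hi δ : ℕ)
    (RS : Finset ((Finset α × Finset α) × (Finset β × Finset β)))
    (hRS : ∀ σ : (Finset α × Finset α) × (Finset β × Finset β), σ ∈ RS ↔ σ.1.1 ⊆ F₁ ∧ σ.2.1 ⊆ F₂ ∧
      σ.1.2 ⊆ J₁ (F₁ \ σ.1.1) ∧ σ.2.2 ⊆ J₂ (F₂ \ σ.2.1) ∧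
      σ.1.2.card + σ.2.2.card = δ ∧ lo ≤ min σ.1.1.card s₁ + min σ.2.1.card s₂ ∧
      min σ.1.1.card s₁ + min σ.2.1.card s₂ ≤ hi ∧
      hi + δ + 1 ≤ min (F₁.card - σ.1.1.card) s₁ + min (F₂.card - σ.2.1.card) s₂)
    (φ₁ : Finset α → ℕ → ℕ → Finset α → Finset α)
    (hφ₁ : ∀ (S : Finset α) (i j : ℕ), i ≤ j → i + j ≤ S.card →
      (Set.InjOn (φ₁ S i j) (S.powersetCard i) ∧ ∀ I ∈ S.powersetCard i, φ₁ S i j I ∈ S.powersetCard j ∧ I ⊆ φ₁ S i j I))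
    (φ₂ : Finset β → ℕ → ℕ → Finset β → Finset β)
    (σ τ : (Finset α × Finset α) × (Finset β × Finset β)) (hσ : σ ∈ RS) (hτ : τ ∈ RS)
    (s1 : s₁ < min σ.1.1.card s₁ + σ.1.2.card) (t2 : s₂ < min τ.2.1.card s₂ + τ.2.2.card) (h : (((F₁ \ σ.1.1) \ σ.1.2, σ.1.2), ((F₂ \ (φ₂ (F₂ \ σ.2.2) σ.2.1.card (σ.2.1.card + (min σ.1.1.card s₁ + σ.1.2.card - s₁)) σ.2.1)) \ σ.2.2, σ.2.2)) = (((F₁ \ (φ₁ (F₁ \ τ.1.2) τ.1.1.card (τ.1.1.card + (min τ.2.1.card s₂ + τ.2.2.card - min (F₂.card - τ.2.1.card) s₂)) τ.1.1)) \ τ.1.2, τ.1.2), (τ.2.1, τ.2.2))) : False := by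
  obtain ⟨y1, y2, y3, -, -⟩ := absorb_S₂ F₁ F₂ s₁ s₂ J₁ J₂ hJ₁ lo hi δ RS hRS φ₁ hφ₁ τ hτ t2
  obtain ⟨⟨I₁, D₁⟩, ⟨I₂, D₂⟩⟩ := σ
  obtain ⟨⟨I₁', D₁'⟩, ⟨I₂', D₂'⟩⟩ := τ
  simp only [Prod.mk.injEq] at h
  obtain ⟨⟨e1, e2⟩, ⟨e3, e4⟩⟩ := h
  subst e2; subst e4
  obtain ⟨sI₁, sI₂, sD₁, sD₂, sδ, slo, shi, sf⟩ := (hRS _).1 hσ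
  obtain ⟨tI₁, tI₂, tD₁, tD₂, tδ, tlo, thi, tf⟩ := (hRS _).1 hτ
  dsimp only at sI₁ sI₂ sD₁ sD₂ sδ slo shi sf tI₁ tI₂ tD₁ tD₂ tδ tlo thi tf s1 t2 e1 e3
  dsimp only at y1 y2 y3
  have hDY : D₁ ⊆ F₁ \ φ₁ (F₁ \ D₁) I₁'.card (I₁'.card + (min I₂'.card s₂ + D₂.card - min (F₂.card - I₂'.card) s₂)) I₁' := by
    intro d hd
    rw [mem_sdiff]
    exact ⟨(mem_sdiff.1 (sD₁.trans (hJ₁ _) hd)).1, fun hdY => (mem_sdiff.1 (y1 hdY)).2 hd⟩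
  have hYeq : I₁ = φ₁ (F₁ \ D₁) I₁'.card (I₁'.card + (min I₂'.card s₂ + D₂.card - min (F₂.card - I₂'.card) s₂)) I₁' :=
    eq_of_sdiff_sdiff_eq sI₁ (y1.trans sdiff_subset) (sD₁.trans (hJ₁ _)) hDY e1
  have hc := congrArg Finset.card hYeq
  rw [y2] at hc
  obtain ⟨r1, -, -, -⟩ := residual_facts (k_o := F₂.card) (i_o := I₂'.card) (s_o := s₂)
    (δ_o := D₂.card) (k_p := F₁.card) (i_p := I₁'.card) (s_p := s₁) (δ_p := D₁.card)
    (hi := hi) (δ := δ) (by omega) (by omega) (by omega) t2 (card_le_card tI₂) (card_le_card tI₁)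
  omega

/-- **L₁ vs L₂**: as `L₁_ne_S₂`, with the smaller absorber `o' ≤ o`. -/
theorem L₁_ne_L₂ (F₁ : Finset α) (F₂ : Finset β) (s₁ s₂ : ℕ) (J₁ : Finset α → Finset α) (J₂ : Finset β → Finset β)
    (hJ₁ : ∀ X, J₁ X ⊆ X) (lo hi δ : ℕ)
    (RS : Finset ((Finset α × Finset α) × (Finset β × Finset β)))
    (hRS : ∀ σ : (Finset α × Finset α) × (Finset β × Finset β), σ ∈ RS ↔ σ.1.1 ⊆ F₁ ∧ σ.2.1 ⊆ F₂ ∧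
      σ.1.2 ⊆ J₁ (F₁ \ σ.1.1) ∧ σ.2.2 ⊆ J₂ (F₂ \ σ.2.1) ∧
      σ.1.2.card + σ.2.2.card = δ ∧ lo ≤ min σ.1.1.card s₁ + min σ.2.1.card s₂ ∧
      min σ.1.1.card s₁ + min σ.2.1.card s₂ ≤ hi ∧
      hi + δ + 1 ≤ min (F₁.card - σ.1.1.card) s₁ + min (F₂.card - σ.2.1.card) s₂)
    (φ₁ : Finset α → ℕ → ℕ → Finset α → Finset α)
    (hφ₁ : ∀ (S : Finset α) (i j : ℕ), i ≤ j → i + j ≤ S.card →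
      (Set.InjOn (φ₁ S i j) (S.powersetCard i) ∧ ∀ I ∈ S.powersetCard i, φ₁ S i j I ∈ S.powersetCard j ∧ I ⊆ φ₁ S i j I))
    (φ₂ : Finset β → ℕ → ℕ → Finset β → Finset β)
    (σ τ : (Finset α × Finset α) × (Finset β × Finset β)) (hσ : σ ∈ RS) (hτ : τ ∈ RS)
    (s1 : s₁ < min σ.1.1.card s₁ + σ.1.2.card) (t2 : s₂ < min τ.2.1.card s₂ + τ.2.2.card) (h : (((F₁ \ σ.1.1) \ σ.1.2, σ.1.2), ((F₂ \ (φ₂ (F₂ \ σ.2.2) σ.2.1.card (σ.2.1.card + (min σ.1.1.card s₁ + σ.1.2.card - s₁)) σ.2.1)) \ σ.2.2, σ.2.2)) = (((F₁ \ (φ₁ (F₁ \ τ.1.2) τ.1.1.card (τ.1.1.card + (min τ.2.1.card s₂ + τ.2.2.card - s₂)) τ.1.1)) \ τ.1.2, τ.1.2), ((F₂ \ τ.2.1) \ τ.2.2, τ.2.2))) : False := by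
  obtain ⟨y1, y2, y3, -, -⟩ := absorb_L₂ F₁ F₂ s₁ s₂ J₁ J₂ hJ₁ lo hi δ RS hRS φ₁ hφ₁ τ hτ t2
  obtain ⟨⟨I₁, D₁⟩, ⟨I₂, D₂⟩⟩ := σ
  obtain ⟨⟨I₁', D₁'⟩, ⟨I₂', D₂'⟩⟩ := τ
  simp only [Prod.mk.injEq] at h
  obtain ⟨⟨e1, e2⟩, ⟨e3, e4⟩⟩ := h
  subst e2; subst e4
  obtain ⟨sI₁, sI₂, sD₁, sD₂, sδ, slo, shi, sf⟩ := (hRS _).1 hσ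
  obtain ⟨tI₁, tI₂, tD₁, tD₂, tδ, tlo, thi, tf⟩ := (hRS _).1 hτ
  dsimp only at sI₁ sI₂ sD₁ sD₂ sδ slo shi sf tI₁ tI₂ tD₁ tD₂ tδ tlo thi tf s1 t2 e1 e3
  dsimp only at y1 y2 y3
  have hDY : D₁ ⊆ F₁ \ φ₁ (F₁ \ D₁) I₁'.card (I₁'.card + (min I₂'.card s₂ + D₂.card - s₂)) I₁' := by
    intro d hd
    rw [mem_sdiff]
    exact ⟨(mem_sdiff.1 (sD₁.trans (hJ₁ _) hd)).1, fun hdY => (mem_sdiff.1 (y1 hdY)).2 hd⟩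
  have hYeq : I₁ = φ₁ (F₁ \ D₁) I₁'.card (I₁'.card + (min I₂'.card s₂ + D₂.card - s₂)) I₁' :=
    eq_of_sdiff_sdiff_eq sI₁ (y1.trans sdiff_subset) (sD₁.trans (hJ₁ _)) hDY e1
  have hc := congrArg Finset.card hYeq
  rw [y2] at hc
  obtain ⟨r1, -, -, -⟩ := residual_facts (k_o := F₂.card) (i_o := I₂'.card) (s_o := s₂)
    (δ_o := D₂.card) (k_p := F₁.card) (i_p := I₁'.card) (s_p := s₁) (δ_p := D₁.card)
    (hi := hi) (δ := δ) (by omega) (by omega) (by omega) t2 (card_le_card tI₂) (card_le_card tI₁)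
  omega

/-- **S₁ vs S₂**: if the S₁-image of `σ` (overflowing on flat 1) is the S₂-image of `τ` (overflowing on flat 2), then the
crossed pair `C₁ σ` equals `(τ's absorber, D₁; σ's absorber, D₂)`, a non-overflowing residual source at the position of
`σ` with corank `s₁ + s₂` — so `σ` is blocked.  Heredity of the selectors gives the kept-point conditions. -/
theorem S₁_ne_S₂ (F₁ : Finset α) (F₂ : Finset β) (s₁ s₂ : ℕ) (J₁ : Finset α → Finset α) (J₂ : Finset β → Finset β)
    (hJ₁ : ∀ X, J₁ X ⊆ X) (hh₁ : ∀ X X', X' ⊆ X → J₁ X ∩ X' ⊆ J₁ X')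
    (hJ₂ : ∀ X, J₂ X ⊆ X) (hh₂ : ∀ X X', X' ⊆ X → J₂ X ∩ X' ⊆ J₂ X') (lo hi δ : ℕ)
    (RS : Finset ((Finset α × Finset α) × (Finset β × Finset β)))
    (hRS : ∀ σ : (Finset α × Finset α) × (Finset β × Finset β), σ ∈ RS ↔ σ.1.1 ⊆ F₁ ∧ σ.2.1 ⊆ F₂ ∧
      σ.1.2 ⊆ J₁ (F₁ \ σ.1.1) ∧ σ.2.2 ⊆ J₂ (F₂ \ σ.2.1) ∧
      σ.1.2.card + σ.2.2.card = δ ∧ lo ≤ min σ.1.1.card s₁ + min σ.2.1.card s₂ ∧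
      min σ.1.1.card s₁ + min σ.2.1.card s₂ ≤ hi ∧
      hi + δ + 1 ≤ min (F₁.card - σ.1.1.card) s₁ + min (F₂.card - σ.2.1.card) s₂)
    (φ₁ : Finset α → ℕ → ℕ → Finset α → Finset α)
    (hφ₁ : ∀ (S : Finset α) (i j : ℕ), i ≤ j → i + j ≤ S.card →
      (Set.InjOn (φ₁ S i j) (S.powersetCard i) ∧ ∀ I ∈ S.powersetCard i, φ₁ S i j I ∈ S.powersetCard j ∧ I ⊆ φ₁ S i j I))
    (φ₂ : Finset β → ℕ → ℕ → Finset β → Finset β)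
    (hφ₂ : ∀ (S : Finset β) (i j : ℕ), i ≤ j → i + j ≤ S.card →
      (Set.InjOn (φ₂ S i j) (S.powersetCard i) ∧ ∀ I ∈ S.powersetCard i, φ₂ S i j I ∈ S.powersetCard j ∧ I ⊆ φ₂ S i j I))
    (σ τ : (Finset α × Finset α) × (Finset β × Finset β)) (hσ : σ ∈ RS) (hτ : τ ∈ RS)
    (s1 : s₁ < min σ.1.1.card s₁ + σ.1.2.card) (sb : ¬ ((((F₁ \ σ.1.1) \ σ.1.2, σ.1.2), (φ₂ (F₂ \ σ.2.2) σ.2.1.card (σ.2.1.card + (min σ.1.1.card s₁ + σ.1.2.card - min (F₁.card - σ.1.1.card) s₁)) σ.2.1, σ.2.2)) ∈ RS ∧ ¬ (s₁ < min ((F₁ \ σ.1.1) \ σ.1.2).card s₁ + σ.1.2.card) ∧ ¬ (s₂ < min (φ₂ (F₂ \ σ.2.2) σ.2.1.card (σ.2.1.card + (min σ.1.1.card s₁ + σ.1.2.card - min (F₁.card - σ.1.1.card) s₁)) σ.2.1).card s₂ + σ.2.2.card))) (t2 : s₂ < min τ.2.1.card s₂ + τ.2.2.card) (h : ((σ.1.1,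 σ.1.2), ((F₂ \ (φ₂ (F₂ \ σ.2.2) σ.2.1.card (σ.2.1.card + (min σ.1.1.card s₁ + σ.1.2.card - min (F₁.card - σ.1.1.card) s₁)) σ.2.1)) \ σ.2.2, σ.2.2)) = (((F₁ \ (φ₁ (F₁ \ τ.1.2) τ.1.1.card (τ.1.1.card + (min τ.2.1.card s₂ + τ.2.2.card - min (F₂.card - τ.2.1.card) s₂)) τ.1.1)) \ τ.1.2, τ.1.2), (τ.2.1, τ.2.2))) : False := by
  obtain ⟨y1, y2, y3, -, -⟩ := absorb_S₁ F₁ F₂ s₁ s₂ J₁ J₂ hJ₂ lo hi δ RS hRS φ₂ hφ₂ σ hσ s1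
  obtain ⟨z1, z2, z3, -, -⟩ := absorb_S₂ F₁ F₂ s₁ s₂ J₁ J₂ hJ₁ lo hi δ RS hRS φ₁ hφ₁ τ hτ t2
  obtain ⟨⟨I₁, D₁⟩, ⟨I₂, D₂⟩⟩ := σ
  obtain ⟨⟨I₁', D₁'⟩, ⟨I₂', D₂'⟩⟩ := τ
  simp only [Prod.mk.injEq] at h
  obtain ⟨⟨e1, e2⟩, ⟨e3, e4⟩⟩ := h
  subst e2; subst e4
  obtain ⟨sI₁, sI₂, sD₁, sD₂, sδ, slo, shi, sf⟩ := (hRS _).1 hσ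
  obtain ⟨tI₁, tI₂, tD₁, tD₂, tδ, tlo, thi, tf⟩ := (hRS _).1 hτ
  dsimp only at sI₁ sI₂ sD₁ sD₂ sδ slo shi sf tI₁ tI₂ tD₁ tD₂ tδ tlo thi tf s1 t2 e1 e3 sb
  dsimp only at y1 y2 y3 z1 z2 z3
  have sD₁F : D₁ ⊆ F₁ \ I₁ := sD₁.trans (hJ₁ _)
  have sD₂F : D₂ ⊆ F₂ \ I₂ := sD₂.trans (hJ₂ _)
  have hDY₂ : D₂ ⊆ F₂ \ φ₂ (F₂ \ D₂) I₂.card (I₂.card + (min I₁.card s₁ + D₁.card - min (F₁.card - I₁.card) s₁)) I₂ := by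
    intro d hd
    rw [mem_sdiff]
    exact ⟨(mem_sdiff.1 (sD₂F hd)).1, fun hdY => (mem_sdiff.1 (y1 hdY)).2 hd⟩
  have hDY₁ : D₁ ⊆ F₁ \ φ₁ (F₁ \ D₁) I₁'.card (I₁'.card + (min I₂'.card s₂ + D₂.card - min (F₂.card - I₂'.card) s₂)) I₁' := by
    intro d hd
    rw [mem_sdiff]
    exact ⟨(mem_sdiff.1 (sD₁F hd)).1, fun hdY => (mem_sdiff.1 (z1 hdY)).2 hd⟩
  have hZF : φ₁ (F₁ \ D₁) I₁'.card (I₁'.card + (min I₂'.card s₂ + D₂.card - min (F₂.card - I₂'.card) s₂)) I₁' ⊆ F₁ := z1.trans sdiff_subset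
  have hYF : φ₂ (F₂ \ D₂) I₂.card (I₂.card + (min I₁.card s₁ + D₁.card - min (F₁.card - I₁.card) s₁)) I₂ ⊆ F₂ := y1.trans sdiff_subset
  have f1 : (F₁ \ I₁) \ D₁ = φ₁ (F₁ \ D₁) I₁'.card (I₁'.card + (min I₂'.card s₂ + D₂.card - min (F₂.card - I₂'.card) s₂)) I₁' := sdiff_sdiff_of_eq hZF hDY₁ e1
  have hcI₂ : I₂'.card = F₂.card - (φ₂ (F₂ \ D₂) I₂.card (I₂.card + (min I₁.card s₁ + D₁.card - min (F₁.card - I₁.card) s₁)) I₂).card - D₂.card := by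
    rw [← e3]; exact card_sdiff_sdiff_eq hYF hDY₂
  have hkZ : D₁ ⊆ J₁ (F₁ \ φ₁ (F₁ \ D₁) I₁'.card (I₁'.card + (min I₂'.card s₂ + D₂.card - min (F₂.card - I₂'.card) s₂)) I₁') := kept_of_subset hJ₁ hh₁ tD₁ z3 z1
  have hkY : D₂ ⊆ J₂ (F₂ \ φ₂ (F₂ \ D₂) I₂.card (I₂.card + (min I₁.card s₁ + D₁.card - min (F₁.card - I₁.card) s₁)) I₂) := kept_of_subset hJ₂ hh₂ sD₂ y3 y1
  have hZcF := card_le_card hZF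
  have hYcF := card_le_card hYF
  have hFo : F₁.card = I₁.card + D₁.card + (φ₁ (F₁ \ D₁) I₁'.card (I₁'.card + (min I₂'.card s₂ + D₂.card - min (F₂.card - I₂'.card) s₂)) I₁').card := by
    have h1 := card_le_card hDY₁
    rw [card_sdiff_of_subset hZF] at h1
    have h2 : I₁.card = F₁.card - (φ₁ (F₁ \ D₁) I₁'.card (I₁'.card + (min I₂'.card s₂ + D₂.card - min (F₂.card - I₂'.card) s₂)) I₁').card - D₁.card := by
      rw [e1]; exact card_sdiff_sdiff_eq hZF hDY₁
    omega
  have hFp : F₂.card = I₂'.card + D₂.card + (φ₂ (F₂ \ D₂) I₂.card (I₂.card + (min I₁.card s₁ + D₁.card - min (F₁.card - I₁.card) s₁)) I₂).card := by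
    have h1 := card_le_card hDY₂
    rw [card_sdiff_of_subset hYF] at h1
    omega
  have c1 : (φ₂ (F₂ \ D₂) I₂.card (I₂.card + (min I₁.card s₁ + D₁.card - min (F₁.card - I₁.card) s₁)) I₂).card + D₂.card < s₂ ∧ min I₂.card s₂ = I₂.card := by
    obtain ⟨r1, -, r3, -⟩ := residual_facts (k_o := F₁.card) (i_o := I₁.card) (s_o := s₁)
      (δ_o := D₁.card) (k_p := F₂.card) (i_p := I₂.card) (s_p := s₂) (δ_p := D₂.card)
      sδ shi sf s1 (card_le_card sI₁) (card_le_card sI₂)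
    clear hcI₂ hFo hFp tf thi tlo
    omega
  have c2 : (φ₁ (F₁ \ D₁) I₁'.card (I₁'.card + (min I₂'.card s₂ + D₂.card - min (F₂.card - I₂'.card) s₂)) I₁').card + D₁.card < s₁ ∧ min I₁'.card s₁ = I₁'.card := by
    obtain ⟨q1, -, q3, -⟩ := residual_facts (k_o := F₂.card) (i_o := I₂'.card) (s_o := s₂)
      (δ_o := D₂.card) (k_p := F₁.card) (i_p := I₁'.card) (s_p := s₁) (δ_p := D₁.card)
      (hi := hi) (δ := δ) (by omega) (by omega) (by omega) t2 (card_le_card tI₂) (card_le_card tI₁)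
    clear hcI₂ hFo hFp sf shi slo
    omega
  have cpos : min (φ₁ (F₁ \ D₁) I₁'.card (I₁'.card + (min I₂'.card s₂ + D₂.card - min (F₂.card - I₂'.card) s₂)) I₁').card s₁ + min (φ₂ (F₂ \ D₂) I₂.card (I₂.card + (min I₁.card s₁ + D₁.card - min (F₁.card - I₁.card) s₁)) I₂).card s₂ = min I₁.card s₁ + min I₂.card s₂ := by
    have m1 : min (F₁.card - I₁.card) s₁ = (φ₁ (F₁ \ D₁) I₁'.card (I₁'.card + (min I₂'.card s₂ + D₂.card - min (F₂.card - I₂'.card) s₂)) I₁').card + D₁.card := by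
      rw [hFo]; clear hFp hcI₂ tf thi tlo; omega
    clear hcI₂ hFo hFp tf thi tlo
    omega
  have ccor : hi + δ + 1 ≤ min (F₁.card - (φ₁ (F₁ \ D₁) I₁'.card (I₁'.card + (min I₂'.card s₂ + D₂.card - min (F₂.card - I₂'.card) s₂)) I₁').card) s₁ + min (F₂.card - (φ₂ (F₂ \ D₂) I₂.card (I₂.card + (min I₁.card s₁ + D₁.card - min (F₁.card - I₁.card) s₁)) I₂).card) s₂ := by
    have m1 : min (F₁.card - (φ₁ (F₁ \ D₁) I₁'.card (I₁'.card + (min I₂'.card s₂ + D₂.card - min (F₂.card - I₂'.card) s₂)) I₁').card) s₁ = s₁ := by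
      rw [hFo]; clear hFp hcI₂ tf thi tlo y2; omega
    have m2 : min (F₂.card - (φ₂ (F₂ \ D₂) I₂.card (I₂.card + (min I₁.card s₁ + D₁.card - min (F₁.card - I₁.card) s₁)) I₂).card) s₂ = s₂ := by
      rw [hFp]; clear hFo hcI₂ tf thi tlo y2; omega
    rw [m1, m2]
    clear hcI₂ hFo hFp tf thi tlo y2 cpos
    omega
  apply sb
  rw [f1]
  refine ⟨?_, ?_, ?_⟩
  · rw [hRS]
    dsimp only
    refine ⟨hZF, hYF, hkZ, hkY, sδ, ?_, ?_, ccor⟩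
    · rw [cpos]; exact slo
    · rw [cpos]; exact shi
  · clear hcI₂ hFo hFp tf thi tlo y2 cpos ccor
    omega
  · clear hcI₂ hFo hFp tf thi tlo y2 cpos ccor
    omega


end TwoFlatPLD

end PercRepro
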